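import Literature.AlgebraicGeometry.Deformation.SmoothLiftGluingSuppliersQuot
import HarnessLib

/-!
# Canonical restricted lifts: the choice-free chart rings of a lifted atlas ([Hartshorne2010] proof of Thm. 10.2 (a); [Oort1971] Lemma (2.2.4))

Layer `Literature/AlgebraicGeometry/Deformation`, namespace `Literature.AlgebraicGeometry.Deformation.CanonicalLiftQuot`.
DEFINITION FILE (four constructions + their API; no instance, no notation, no named fact, no `sorry`).  Quotient-currency (U) organ of the
cell `hodgecm-mathlib` (P6 sub-desk P6b; count-neutral): the replacement, in the mixed-characteristic port of [Oort1971] Thm. (2.2.1), of the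
k-currency's CHOICE-FREE chart ring `A' ⊗_k Γ(W)` (★ `SmoothSchemeLiftObstructionCechCocycle`).

THE POINT.  In the quotient currency a local lift of `Γ(X₀, V)` is an abstract `A'`-algebra `P` with `r : P ↠ Γ(X₀, V)`, `ker r = J P`; its
restriction to a principal open `W = D(f) ⊆ V` was so far ANY localisation `P[1/f̃]` at ANY lift `f̃` of `f` (★ (U-loc), ★ `SmoothLiftAtlasQuot`),
so deeper overlaps carried towers of choices.  Here the restriction is made CANONICAL: invert exactly the elements of `P` whose reduction is a
unit on `W`,
  `L(r, g) := P[M⁻¹]`, `M = {p ∈ P : g (r p) ∈ Γ(X₀, W)ˣ}` (`g : Γ(X₀, V) → Γ(X₀, W)` the restriction),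
which depends on `W` only (through `g`), not on a chosen equation of `W`.  Since `ker (P[1/f̃] ↠ Γ(X₀, W)) = J·P[1/f̃]` is nilpotent, every
element of `M` is already a unit in `P[1/f̃]` (units lift modulo nilpotents), so `L(r, g) = P[1/f̃]` for EVERY admissible `f̃` (§2): all ★
quotient-currency theorems apply to `L(r, g)`, and in addition reductions and restrictions between the `L`'s are canonical and compose on the
nose (§3, §5) — which is what an INDEXED atlas (Čech cochains, `Scheme.GlueData`) needs.

* §1 `liftSubmonoid r g`, `CanonicalLift r g := Localization (liftSubmonoid r g)` (an `abbrev`: it inherits Mathlib's `Localization` instances).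
* §2 `isLocalization_away`: `L(r, g)` is the localisation of `P` away from ANY `c` with `Γ(X₀, W) = Γ(X₀, V)[1/r c]`.
* §3 `reduction r g hg : L(r, g) →ₐ[A'] Γ(X₀, W)` (units by definition), `reduction_algebraMap`, onto, `ker = J·L`.
* §4 flat, formally smooth (with `P`).
* §5 `restrict : L(r, g) →ₐ[A'] L(r, g″)` along `liftSubmonoid r g ≤ liftSubmonoid r g″` (e.g. `g″ = g′ ∘ g`): over `P`, unique, transitive,
  compatible with the reductions.

Ring-level and scheme-free: on a scheme, `g` is `(X₀.presheaf.map (homOfLE _).op).hom` and the localisation hypothesis of §2 is Mathlib's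
`IsAffineOpen.isLocalization_of_eq_basicOpen` (stated, as there, with the explicit algebra structure `g.toAlgebra`).

HC_CM is proved only modulo the printed citations until rung 0 closes; nothing here bears on a summit statement.

## References
* [Hartshorne2010] R. Hartshorne, *Deformation Theory*, GTM 257, Springer (2010): Thm. 10.2 (a) and its proof (p. 81), Prop. 2.2 (p. 10).
* [Oort1971] F. Oort, *Finite group schemes, local moduli for abelian varieties, and lifting problems*, Compositio Math. 23 (1971),
  Lemma (2.2.4) (p. 274).
* [StacksProject] The Stacks Project, Tag 00CP (localisation of localisations), Tag 00CM (localisation is exact).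
-/

noncomputable section

open scoped TensorProduct

universe u

namespace Literature.AlgebraicGeometry.Deformation.CanonicalLiftQuot

open Literature.AlgebraicGeometry.Deformation.LiftLocalizationQuot Literature.AlgebraicGeometry.Deformation.LiftGluingSuppliersQuot

variable {A' : Type u} [CommRing A'] {P : Type u} [CommRing P] [Algebra A' P] {Q : Type u} [CommRing Q] [Algebra A' Q]
  {Q' : Type u} [CommRing Q'] {Q'' : Type u} [CommRing Q'']

/-! ## §1 The submonoid of elements invertible on the smaller open, and the canonical restricted lift -/

/-- The elements of the lift `P` whose reduction `r` becomes a UNIT after the restriction `g : Q → Q'` (on a scheme: the functions on the chart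
that are invertible on the smaller open `W`). [cite: Hartshorne2010, Thm. 10.2 (a) (proof), p. 81] -/
def liftSubmonoid (r : P →ₐ[A'] Q) (g : Q →+* Q') : Submonoid P :=
  (IsUnit.submonoid Q').comap (g.comp (r : P →+* Q))

/-- Membership in `liftSubmonoid r g`: the reduction becomes a unit after restriction. [cite: Hartshorne2010, Thm. 10.2 (a) (proof), p. 81] -/
theorem mem_liftSubmonoid_iff (r : P →ₐ[A'] Q) (g : Q →+* Q') (p : P) : p ∈ liftSubmonoid r g ↔ IsUnit (g (r p)) := by
  simp only [liftSubmonoid, Submonoid.mem_comap, RingHom.coe_comp, Function.comp_apply, IsUnit.mem_submonoid_iff]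
  rfl

/-- Restricting further only enlarges the submonoid: `liftSubmonoid r g ≤ liftSubmonoid r g″` when `g″ = g′ ∘ g`.
[cite: Hartshorne2010, Thm. 10.2 (a) (proof), p. 81] -/
theorem liftSubmonoid_mono (r : P →ₐ[A'] Q) (g : Q →+* Q') (g'' : Q →+* Q'') (g' : Q' →+* Q'') (h : ∀ q, g'' q = g' (g q)) :
    liftSubmonoid r g ≤ liftSubmonoid r g'' := fun p hp => by
  rw [mem_liftSubmonoid_iff] at hp ⊢
  rw [h]
  exact hp.map g'

/-- **The canonical restricted lift** `L(r, g) = P[M⁻¹]`, `M = liftSubmonoid r g`: the lift `P` of the chart ring `Q` restricted to the smaller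
open with ring `Q'`, with NO choice of an equation (an `abbrev` of Mathlib's `Localization`, so it is a `CommRing`, a `P`- and an `A'`-algebra in a
tower, and `IsLocalization (liftSubmonoid r g)`). [cite: Hartshorne2010, Thm. 10.2 (a) (proof), p. 81] [cite: Oort1971, Lemma (2.2.4) (p. 274)] -/
abbrev CanonicalLift (r : P →ₐ[A'] Q) (g : Q →+* Q') : Type u :=
  Localization (liftSubmonoid r g)

/-! ## §2 The canonical lift is the localisation away from any admissible equation -/

/-- **`L(r, g) = P[1/c]` for every lift `c` of an equation of the smaller open.**  If `r : P ↠ Q` has nilpotent kernel `J P` and `Q'` is the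
localisation of `Q` away from `r c` (through `g`), then `L(r, g)` is the localisation of `P` away from EVERY lift `c` of that equation `q`: every element of `liftSubmonoid r g`
is already a unit in `P[1/c]`, units lifting along the nilpotent-kernel surjection `P[1/c] ↠ Q'` (★ (U-loc) `isUnit_of_isUnit_map`).
[cite: StacksProject, Tag 00CP] [cite: Hartshorne2010, Thm. 10.2 (a) (proof), p. 81] -/
theorem isLocalization_away [Algebra A' Q'] {J : Ideal A'} (hJ : IsNilpotent J) (r : P →ₐ[A'] Q) (hr : Function.Surjective r)
    (hkr : RingHom.ker r = J.map (algebraMap A' P)) (g : Q →+* Q') (hg : ∀ a, g (algebraMap A' Q a) = algebraMap A' Q' a) {q : Q}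
    (hQ' : @IsLocalization.Away Q _ q Q' _ g.toAlgebra) (c : P) (hc : r c = q) : IsLocalization.Away c (CanonicalLift r g) := by
  subst hc
  letI := g.toAlgebra
  haveI : IsScalarTower A' Q Q' := IsScalarTower.of_algebraMap_eq fun a => (hg a).symm
  -- the chosen localisation `P[1/c]` and its reduction onto `Q'`
  obtain ⟨rS, hrS⟩ := exists_algHom_away (S := Localization.Away c) (B' := Q') r c
  have hsurj := surjective_algHom_away r hr c rS hrS
  have hker := ker_algHom_away J r hkr c rS hrS
  -- every element of `liftSubmonoid r g` is a unit in `P[1/c]`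
  have hunit : ∀ p ∈ liftSubmonoid r g, IsUnit (algebraMap P (Localization.Away c) p) := fun p hp => by
    refine isUnit_of_isUnit_map (rS : Localization.Away c →+* Q') hsurj ?_ ?_
    · rw [show RingHom.ker (rS : Localization.Away c →+* Q') = J.map (algebraMap A' (Localization.Away c)) from hker]
      exact isNilpotent_map_of_isNilpotent hJ
    · rw [RingHom.coe_coe, hrS]
      exact (mem_liftSubmonoid_iff r g p).mp hp
  have hle : Submonoid.powers c ≤ liftSubmonoid r g := by
    rw [Submonoid.powers_le, mem_liftSubmonoid_iff]
    change IsUnit (algebraMap Q Q' (r c))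
    exact IsLocalization.Away.algebraMap_isUnit (r c)
  -- so `P[1/c]` is also the localisation at `liftSubmonoid r g`, and `L(r, g) ≅ P[1/c]` over `P`
  haveI : IsLocalization (liftSubmonoid r g) (Localization.Away c) := IsLocalization.of_le (Submonoid.powers c) _ hle hunit
  exact IsLocalization.isLocalization_of_algEquiv (Submonoid.powers c)
    (IsLocalization.algEquiv (liftSubmonoid r g) (Localization.Away c) (CanonicalLift r g))

/-! ## §3 The canonical reduction -/

/-- **The canonical reduction** `L(r, g) →ₐ[A'] Q'`, `p/m ↦ g(r p) · g(r m)⁻¹` — well defined because the elements of `liftSubmonoid r g` are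
units in `Q'` BY DEFINITION (no choice).  [cite: Hartshorne2010, Thm. 10.2 (a) (proof), p. 81] [cite: Oort1971, Lemma (2.2.4) (p. 274)] -/
def reduction [Algebra A' Q'] (r : P →ₐ[A'] Q) (g : Q →+* Q') (hg : ∀ a, g (algebraMap A' Q a) = algebraMap A' Q' a) : CanonicalLift r g →ₐ[A'] Q' :=
  IsLocalization.liftAlgHom (M := liftSubmonoid r g) (f := (AlgHom.mk g hg).comp r) fun y => (mem_liftSubmonoid_iff r g y.1).mp y.2

/-- The canonical reduction extends `g ∘ r`: `red (p/1) = g (r p)`. [cite: Hartshorne2010, Thm. 10.2 (a) (proof), p. 81] -/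
theorem reduction_algebraMap [Algebra A' Q'] (r : P →ₐ[A'] Q) (g : Q →+* Q') (hg : ∀ a, g (algebraMap A' Q a) = algebraMap A' Q' a) (p : P) :
    reduction r g hg (algebraMap P (CanonicalLift r g) p) = g (r p) := by
  rw [reduction, IsLocalization.liftAlgHom_apply, IsLocalization.lift_eq]
  rfl

/-- The canonical reduction is ONTO (given an equation `q` of the smaller open: `Q' = Q[1/q]`, §2). [cite: Hartshorne2010, Thm. 10.2 (a) (proof), p. 81] -/
theorem reduction_surjective [Algebra A' Q'] {J : Ideal A'} (hJ : IsNilpotent J) (r : P →ₐ[A'] Q) (hr : Function.Surjective r)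
    (hkr : RingHom.ker r = J.map (algebraMap A' P)) (g : Q →+* Q') (hg : ∀ a, g (algebraMap A' Q a) = algebraMap A' Q' a) {q : Q}
    (hQ' : @IsLocalization.Away Q _ q Q' _ g.toAlgebra) : Function.Surjective (reduction r g hg) := by
  obtain ⟨c, rfl⟩ := hr q
  letI := g.toAlgebra
  haveI : IsScalarTower A' Q Q' := IsScalarTower.of_algebraMap_eq fun a => (hg a).symm
  haveI := isLocalization_away hJ r hr hkr g hg hQ' c rfl
  exact surjective_algHom_away r hr c (reduction r g hg) fun x => reduction_algebraMap r g hg x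

/-- The canonical reduction has kernel `J · L(r, g)` (given an equation `q` of the smaller open, §2). [cite: Hartshorne2010, Thm. 10.2 (a) (proof), p. 81] -/
theorem ker_reduction [Algebra A' Q'] {J : Ideal A'} (hJ : IsNilpotent J) (r : P →ₐ[A'] Q) (hr : Function.Surjective r)
    (hkr : RingHom.ker r = J.map (algebraMap A' P)) (g : Q →+* Q') (hg : ∀ a, g (algebraMap A' Q a) = algebraMap A' Q' a) {q : Q}
    (hQ' : @IsLocalization.Away Q _ q Q' _ g.toAlgebra) :
    RingHom.ker (reduction r g hg) = J.map (algebraMap A' (CanonicalLift r g)) := by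
  obtain ⟨c, rfl⟩ := hr q
  letI := g.toAlgebra
  haveI : IsScalarTower A' Q Q' := IsScalarTower.of_algebraMap_eq fun a => (hg a).symm
  haveI := isLocalization_away hJ r hr hkr g hg hQ' c rfl
  exact ker_algHom_away J r hkr c (reduction r g hg) fun x => reduction_algebraMap r g hg x

/-! ## §4 Flatness and formal smoothness -/

/-- `L(r, g)` is flat over `A'` when `P` is. [cite: Hartshorne2010, Prop. 2.2, p. 10] [cite: StacksProject, Tag 00CM] -/
theorem flat (r : P →ₐ[A'] Q) (g : Q →+* Q') [Module.Flat A' P] : Module.Flat A' (CanonicalLift r g) :=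
  flat_of_isLocalization (S := CanonicalLift r g) (liftSubmonoid r g)

/-- `L(r, g)` is formally smooth over `A'` when `P` is. [cite: Hartshorne2010, Thm. 10.2 (a) (proof), p. 81] [cite: StacksProject, Tag 00CP] -/
theorem formallySmooth (r : P →ₐ[A'] Q) (g : Q →+* Q') [Algebra.FormallySmooth A' P] :
    Algebra.FormallySmooth A' (CanonicalLift r g) :=
  formallySmooth_of_isLocalization (S := CanonicalLift r g) (liftSubmonoid r g)

/-! ## §5 The canonical restriction maps -/

/-- **The canonical restriction** `L(r, g) →ₐ[A'] L(r, g″)` along an inclusion of submonoids (for `g″ = g′ ∘ g`: `liftSubmonoid_mono`) — the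
unique `P`-algebra map. [cite: Hartshorne2010, Thm. 10.2 (a) (proof), p. 81] [cite: StacksProject, Tag 00CP] -/
def restrict (r : P →ₐ[A'] Q) (g : Q →+* Q') (g'' : Q →+* Q'') (hle : liftSubmonoid r g ≤ liftSubmonoid r g'') :
    CanonicalLift r g →ₐ[A'] CanonicalLift r g'' :=
  IsLocalization.liftAlgHom (M := liftSubmonoid r g) (f := IsScalarTower.toAlgHom A' P (CanonicalLift r g''))
    fun y => IsLocalization.map_units (CanonicalLift r g'') ⟨y.1, hle y.2⟩

/-- The canonical restriction is a map over `P`: `restrict (p/1) = p/1`. [cite: StacksProject, Tag 00CP] -/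
theorem restrict_algebraMap (r : P →ₐ[A'] Q) (g : Q →+* Q') (g'' : Q →+* Q'') (hle : liftSubmonoid r g ≤ liftSubmonoid r g'') (p : P) :
    restrict r g g'' hle (algebraMap P (CanonicalLift r g) p) = algebraMap P (CanonicalLift r g'') p := by
  rw [restrict, IsLocalization.liftAlgHom_apply, IsLocalization.lift_eq]
  rfl

/-- **Uniqueness:** an `A'`-algebra map `L(r, g) → L(r, g″)` over `P` IS the canonical restriction. [cite: StacksProject, Tag 00CP] -/
theorem restrict_unique (r : P →ₐ[A'] Q) (g : Q →+* Q') (g'' : Q →+* Q'') (hle : liftSubmonoid r g ≤ liftSubmonoid r g'')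
    (φ : CanonicalLift r g →ₐ[A'] CanonicalLift r g'')
    (hφ : ∀ p, φ (algebraMap P (CanonicalLift r g) p) = algebraMap P (CanonicalLift r g'') p) : φ = restrict r g g'' hle :=
  algHom_ext_of_isLocalization (liftSubmonoid r g) φ _ fun p => by rw [hφ, restrict_algebraMap]

/-- The restriction to itself is the identity. [cite: StacksProject, Tag 00CP] -/
theorem restrict_self (r : P →ₐ[A'] Q) (g : Q →+* Q') (x : CanonicalLift r g) : restrict r g g le_rfl x = x := by
  rw [← restrict_unique r g g le_rfl (AlgHom.id A' _) fun p => rfl]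
  rfl

/-- **Transitivity:** restricting in two steps is restricting in one (the `L`'s form a genuine presheaf on the principal opens of the chart).
[cite: Hartshorne2010, Thm. 10.2 (a) (proof), p. 81] [cite: StacksProject, Tag 00CP] -/
theorem restrict_restrict {Q''' : Type u} [CommRing Q'''] (r : P →ₐ[A'] Q) (g : Q →+* Q') (g'' : Q →+* Q'') (g''' : Q →+* Q''')
    (h₁ : liftSubmonoid r g ≤ liftSubmonoid r g'') (h₂ : liftSubmonoid r g'' ≤ liftSubmonoid r g''') (x : CanonicalLift r g) :
    restrict r g'' g''' h₂ (restrict r g g'' h₁ x) = restrict r g g''' (h₁.trans h₂) x := by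
  rw [← AlgHom.comp_apply,
    restrict_unique r g g''' (h₁.trans h₂) ((restrict r g'' g''' h₂).comp (restrict r g g'' h₁)) fun p => by
      rw [AlgHom.comp_apply, restrict_algebraMap, restrict_algebraMap]]

/-- **Restriction is compatible with the reductions:** `red″ ∘ restrict = g′ ∘ red` for `g″ = g′ ∘ g`.
[cite: Hartshorne2010, Thm. 10.2 (a) (proof), p. 81] -/
theorem reduction_restrict [Algebra A' Q'] [Algebra A' Q''] (r : P →ₐ[A'] Q) (g : Q →+* Q') (hg : ∀ a, g (algebraMap A' Q a) = algebraMap A' Q' a)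
    (g'' : Q →+* Q'') (hg'' : ∀ a, g'' (algebraMap A' Q a) = algebraMap A' Q'' a) (g' : Q' →+* Q'') (h : ∀ q, g'' q = g' (g q))
    (x : CanonicalLift r g) :
    reduction r g'' hg'' (restrict r g g'' (liftSubmonoid_mono r g g'' g' h) x) = g' (reduction r g hg x) := by
  have key : ((reduction r g'' hg'').comp (restrict r g g'' (liftSubmonoid_mono r g g'' g' h)) : CanonicalLift r g →+* Q'') =
      g'.comp (reduction r g hg : CanonicalLift r g →+* Q') :=
    IsLocalization.ringHom_ext (liftSubmonoid r g) (RingHom.ext fun p => by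
      simp only [RingHom.coe_comp, RingHom.coe_coe, Function.comp_apply, AlgHom.comp_apply, restrict_algebraMap, reduction_algebraMap, h])
  exact congrArg (fun f : CanonicalLift r g →+* Q'' => f x) key

end Literature.AlgebraicGeometry.Deformation.CanonicalLiftQuot

end
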